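import Summits.KontsevichZagierPeriods.Zeta5Search.Barrier.ConeGammaS7CritCoords

/-!
# ζ(5) search — BARRIER: the critical-value cocycle for the block generators `(34)`, `(45)` and BZ's reversal `π`

HONEST FRAMING (cell `pub-zeta5`): systematic search; no irrationality claim unless kernel-certified. MODEL objects
under Brown–Zudilin's (28)+(30) accounting ([BZ22] = arXiv:2210.03391; (28) observed, not proved); statements about
BZ's §5 critical system and growth functional under the hypergeometric group; nothing here is about the size of any
critical value, the cone's supremum (C2 = `BarrierC2`, OPEN), S-E (CONJECTURED) or `ζ(5)`. No number or sentence of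
record moves. Records in print UNMOVED. Prover P2 g21 (self-selected Lean-only item, file 4).

Three of the four generators of `S₇ = ⟨(34), (45), π, (56)⟩` (`π = (14)(23)(57)`, BZ's reversal `p ↦ (p₆,…,p₀)`,
`q ↦ (q₅,…,q₁)`) act on BZ's critical POINTS trivially: `(34)` and `(45)` (inside the `x`-block `{s₃,s₄,s₅}`) fix
`(x, y)` — `F₁`, `F₂` and the twelve factors are permuted among themselves, only the constants `q₁ log q₁`,
`(p₃… )`, `p₀ log p₀` of the growth functional move — and `π` sends `(x, y) ↦ (y, x)` with `F₁ ↔ F₂`. Hence, for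
EVERY real direction (no box, no side condition) and `t ∈ {(34), (45), π}` (as `Equiv.swap 2 3`, `Equiv.swap 3 4`,
`Equiv.swap 0 3 * Equiv.swap 1 2 * Equiv.swap 4 6` on `Fin 7`):
* `isCritical_growthLogR_swap23 / _swap34 / _mirror` — pointwise transfer with the growth shifted by the F-entropy
  cocycle `ΔE(t; a)` (`ΔE(π; a) = 0` termwise);
* **`critVals_permAct_swap23 / _swap34 / _mirror`** — the SET cocycle `critVals (t·a) = (· + ΔE(t;a)) '' critVals a`,
  unconditionally; so `gamma_permAct_of_critShift` / `C1_…`/`C0_of_critVals_eq_image` (P2 g20) apply to these `t`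
  at every Regular direction of the closed box.
The fourth generator `(56)` moves critical points by a Möbius map and is only generically loss-free
(`ConeGammaS7CritSwap`, `ConeGammaS7CritOrbit`).
-/

noncomputable section

open Finset

namespace Summit.KontsevichZagierPeriods.Zeta5Search.Barrier.ConeGamma

/-! ### `(34)`: `Equiv.swap 2 3` -/

/-- **`(34)` fixes critical points and shifts the growth by `ΔE`.** -/
theorem isCritical_growthLogR_swap23 {s : Fin 8 → ℝ} {x y : ℝ} (hc : IsCritical (aOfS s) x y) :
    IsCritical (aOfS (permS (Equiv.swap 2 3) s)) x y
    ∧ growthLogR (pR (aOfS (permS (Equiv.swap 2 3) s))) (qR (aOfS (permS (Equiv.swap 2 3) s))) x y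
      = growthLogR (pR (aOfS s)) (qR (aOfS s)) x y
        + (∑ i ∈ FIdx, h28 (aOfS (permS (Equiv.swap 2 3) s)) i * Real.log (h28 (aOfS (permS (Equiv.swap 2 3) s)) i)
          - ∑ i ∈ FIdx, h28 (aOfS s) i * Real.log (h28 (aOfS s) i)) := by
  obtain ⟨e0, e1, e2, e3, e4, e5, e6, e7⟩ := permS_swap23_apply s
  obtain ⟨hF1, hF2, hv⟩ := hc
  rw [F1R_aOfS] at hF1
  rw [F2R_aOfS] at hF2
  rw [critFactors_aOfS] at hv
  have hv0 : x - (s 4 + s 6) ≠ 0 := by simpa using hv 0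
  have hv1 : x - (s 3 + s 6) ≠ 0 := by simpa using hv 1
  have hv2 : x - (s 5 + s 6) ≠ 0 := by simpa using hv 2
  have hv3 : x + y - (s 0 + s 6) ≠ 0 := by simpa using hv 3
  have hv4 : s 0 + s 6 - x ≠ 0 := by simpa using hv 4
  have hv5 : s 3 + s 4 + s 5 + s 6 - x ≠ 0 := by simpa using hv 5
  have hv6 : x + y - 2 * s 6 ≠ 0 := by simpa using hv 6
  have hv7 : y - (s 6 + s 7) ≠ 0 := by simpa using hv 7
  have hv8 : y - (s 2 + s 6) ≠ 0 := by simpa using hv 8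
  have hv9 : y - (s 1 + s 6) ≠ 0 := by simpa using hv 9
  have hv10 : s 1 + s 2 + s 6 + s 7 - y ≠ 0 := by simpa using hv 10
  have hv11 : s 0 + s 6 - y ≠ 0 := by simpa using hv 11
  refine ⟨⟨?_, ?_, ?_⟩, ?_⟩
  · rw [F1R_aOfS]; simp only [e0, e3, e4, e5, e6]; linear_combination hF1
  · rw [F2R_aOfS]; simp only [e0, e1, e2, e6, e7]; linear_combination hF2
  · rw [critFactors_aOfS]; simp only [e0, e1, e2, e3, e4, e5, e6, e7]
    intro k; fin_cases k <;> simp only [Fin.isValue, Matrix.cons_val, Fin.zero_eta, Fin.mk_one, Fin.reduceFinMk,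
      Matrix.cons_val_zero, Matrix.cons_val_one, ne_eq]
    · exact hv1
    · exact hv0
    · exact hv2
    · exact hv3
    · exact hv4
    · exact fun h => hv5 (by linear_combination h)
    · exact hv6
    · exact hv7
    · exact hv8
    · exact hv9
    · exact hv10
    · exact hv11
  · rw [growthLogR_aOfS, growthLogR_aOfS, sum_FIdx_mul_log_aOfS, sum_FIdx_mul_log_aOfS]
    simp only [e0, e1, e2, e3, e4, e5, e6, e7]
    have hb : Real.log (s 4 + s 3 + s 5 + s 6 - x) = Real.log (s 3 + s 4 + s 5 + s 6 - x) := by congr 1; ring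
    linear_combination (-(s 4 + s 3 + s 5 + s 6)) * hb

/-! ### `(45)`: `Equiv.swap 3 4` -/

/-- **`(45)` fixes critical points and shifts the growth by `ΔE`.** -/
theorem isCritical_growthLogR_swap34 {s : Fin 8 → ℝ} {x y : ℝ} (hc : IsCritical (aOfS s) x y) :
    IsCritical (aOfS (permS (Equiv.swap 3 4) s)) x y
    ∧ growthLogR (pR (aOfS (permS (Equiv.swap 3 4) s))) (qR (aOfS (permS (Equiv.swap 3 4) s))) x y
      = growthLogR (pR (aOfS s)) (qR (aOfS s)) x y
        + (∑ i ∈ FIdx, h28 (aOfS (permS (Equiv.swap 3 4) s)) i * Real.log (h28 (aOfS (permS (Equiv.swap 3 4) s)) i)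
          - ∑ i ∈ FIdx, h28 (aOfS s) i * Real.log (h28 (aOfS s) i)) := by
  obtain ⟨e0, e1, e2, e3, e4, e5, e6, e7⟩ := permS_swap34_apply s
  obtain ⟨hF1, hF2, hv⟩ := hc
  rw [F1R_aOfS] at hF1
  rw [F2R_aOfS] at hF2
  rw [critFactors_aOfS] at hv
  have hv0 : x - (s 4 + s 6) ≠ 0 := by simpa using hv 0
  have hv1 : x - (s 3 + s 6) ≠ 0 := by simpa using hv 1
  have hv2 : x - (s 5 + s 6) ≠ 0 := by simpa using hv 2
  have hv3 : x + y - (s 0 + s 6) ≠ 0 := by simpa using hv 3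
  have hv4 : s 0 + s 6 - x ≠ 0 := by simpa using hv 4
  have hv5 : s 3 + s 4 + s 5 + s 6 - x ≠ 0 := by simpa using hv 5
  have hv6 : x + y - 2 * s 6 ≠ 0 := by simpa using hv 6
  have hv7 : y - (s 6 + s 7) ≠ 0 := by simpa using hv 7
  have hv8 : y - (s 2 + s 6) ≠ 0 := by simpa using hv 8
  have hv9 : y - (s 1 + s 6) ≠ 0 := by simpa using hv 9
  have hv10 : s 1 + s 2 + s 6 + s 7 - y ≠ 0 := by simpa using hv 10
  have hv11 : s 0 + s 6 - y ≠ 0 := by simpa using hv 11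
  refine ⟨⟨?_, ?_, ?_⟩, ?_⟩
  · rw [F1R_aOfS]; simp only [e0, e3, e4, e5, e6]; linear_combination hF1
  · rw [F2R_aOfS]; simp only [e0, e1, e2, e6, e7]; linear_combination hF2
  · rw [critFactors_aOfS]; simp only [e0, e1, e2, e3, e4, e5, e6, e7]
    intro k; fin_cases k <;> simp only [Fin.isValue, Matrix.cons_val, Fin.zero_eta, Fin.mk_one, Fin.reduceFinMk,
      Matrix.cons_val_zero, Matrix.cons_val_one, ne_eq]
    · exact hv2
    · exact hv1
    · exact hv0
    · exact hv3
    · exact hv4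
    · exact fun h => hv5 (by linear_combination h)
    · exact hv6
    · exact hv7
    · exact hv8
    · exact hv9
    · exact hv10
    · exact hv11
  · rw [growthLogR_aOfS, growthLogR_aOfS, sum_FIdx_mul_log_aOfS, sum_FIdx_mul_log_aOfS]
    simp only [e0, e1, e2, e3, e4, e5, e6, e7]
    have hb : Real.log (s 3 + s 5 + s 4 + s 6 - x) = Real.log (s 3 + s 4 + s 5 + s 6 - x) := by congr 1; ring
    linear_combination (-(s 3 + s 5 + s 4 + s 6)) * hb

/-! ### BZ's reversal `π = (14)(23)(57)`: `Equiv.swap 0 3 * Equiv.swap 1 2 * Equiv.swap 4 6` -/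

/-- **`π` sends the critical point `(x, y)` to `(y, x)` and preserves the growth (`ΔE(π; a) = 0` termwise).** -/
theorem isCritical_growthLogR_mirror {s : Fin 8 → ℝ} {x y : ℝ} (hc : IsCritical (aOfS s) x y) :
    IsCritical (aOfS (permS (Equiv.swap 0 3 * Equiv.swap 1 2 * Equiv.swap 4 6) s)) y x
    ∧ growthLogR (pR (aOfS (permS (Equiv.swap 0 3 * Equiv.swap 1 2 * Equiv.swap 4 6) s)))
        (qR (aOfS (permS (Equiv.swap 0 3 * Equiv.swap 1 2 * Equiv.swap 4 6) s))) y x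
      = growthLogR (pR (aOfS s)) (qR (aOfS s)) x y
        + (∑ i ∈ FIdx, h28 (aOfS (permS (Equiv.swap 0 3 * Equiv.swap 1 2 * Equiv.swap 4 6) s)) i
            * Real.log (h28 (aOfS (permS (Equiv.swap 0 3 * Equiv.swap 1 2 * Equiv.swap 4 6) s)) i)
          - ∑ i ∈ FIdx, h28 (aOfS s) i * Real.log (h28 (aOfS s) i)) := by
  obtain ⟨e0, e1, e2, e3, e4, e5, e6, e7⟩ := permS_mirror_apply s
  obtain ⟨hF1, hF2, hv⟩ := hc
  rw [F1R_aOfS] at hF1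
  rw [F2R_aOfS] at hF2
  rw [critFactors_aOfS] at hv
  have hv0 : x - (s 4 + s 6) ≠ 0 := by simpa using hv 0
  have hv1 : x - (s 3 + s 6) ≠ 0 := by simpa using hv 1
  have hv2 : x - (s 5 + s 6) ≠ 0 := by simpa using hv 2
  have hv3 : x + y - (s 0 + s 6) ≠ 0 := by simpa using hv 3
  have hv4 : s 0 + s 6 - x ≠ 0 := by simpa using hv 4
  have hv5 : s 3 + s 4 + s 5 + s 6 - x ≠ 0 := by simpa using hv 5
  have hv6 : x + y - 2 * s 6 ≠ 0 := by simpa using hv 6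
  have hv7 : y - (s 6 + s 7) ≠ 0 := by simpa using hv 7
  have hv8 : y - (s 2 + s 6) ≠ 0 := by simpa using hv 8
  have hv9 : y - (s 1 + s 6) ≠ 0 := by simpa using hv 9
  have hv10 : s 1 + s 2 + s 6 + s 7 - y ≠ 0 := by simpa using hv 10
  have hv11 : s 0 + s 6 - y ≠ 0 := by simpa using hv 11
  refine ⟨⟨?_, ?_, ?_⟩, ?_⟩
  · rw [F1R_aOfS]; simp only [e0, e3, e4, e5, e6]; linear_combination hF2
  · rw [F2R_aOfS]; simp only [e0, e1, e2, e6, e7]; linear_combination hF1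
  · rw [critFactors_aOfS]; simp only [e0, e1, e2, e3, e4, e5, e6, e7]
    intro k; fin_cases k <;> simp only [Fin.isValue, Matrix.cons_val, Fin.zero_eta, Fin.mk_one, Fin.reduceFinMk,
      Matrix.cons_val_zero, Matrix.cons_val_one, ne_eq]
    · exact hv9
    · exact hv8
    · exact fun h => hv7 (by linear_combination h)
    · exact fun h => hv3 (by linear_combination h)
    · exact hv11
    · exact fun h => hv10 (by linear_combination h)
    · exact fun h => hv6 (by linear_combination h)
    · exact fun h => hv2 (by linear_combination h)
    · exact hv1
    · exact hv0
    · exact fun h => hv5 (by linear_combination h)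
    · exact hv4
  · rw [growthLogR_aOfS, growthLogR_aOfS, sum_FIdx_mul_log_aOfS, sum_FIdx_mul_log_aOfS]
    simp only [e0, e1, e2, e3, e4, e5, e6, e7]
    have a7 : Real.log (y - (s 7 + s 6)) = Real.log (y - (s 6 + s 7)) := by congr 1; ring
    have a3 : Real.log (y + x - (s 0 + s 6)) = Real.log (x + y - (s 0 + s 6)) := by congr 1; ring
    have a10 : Real.log (s 2 + s 1 + s 7 + s 6 - y) = Real.log (s 1 + s 2 + s 6 + s 7 - y) := by congr 1; ring
    have a6 : Real.log (y + x - 2 * s 6) = Real.log (x + y - 2 * s 6) := by congr 1; ring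
    have a2 : Real.log (x - (s 6 + s 5)) = Real.log (x - (s 5 + s 6)) := by congr 1; ring
    have a5 : Real.log (s 4 + s 3 + s 6 + s 5 - x) = Real.log (s 3 + s 4 + s 5 + s 6 - x) := by congr 1; ring
    have c32 : Real.log (s 3 + s 2) = Real.log (s 2 + s 3) := by rw [add_comm]
    have c76 : Real.log (s 7 + s 6) = Real.log (s 6 + s 7) := by rw [add_comm]
    have c65 : Real.log (s 6 + s 5) = Real.log (s 5 + s 6) := by rw [add_comm]
    have c42 : Real.log (s 4 + s 2) = Real.log (s 2 + s 4) := by rw [add_comm]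
    have c41 : Real.log (s 4 + s 1) = Real.log (s 1 + s 4) := by rw [add_comm]
    have c31 : Real.log (s 3 + s 1) = Real.log (s 1 + s 3) := by rw [add_comm]
    have c75 : Real.log (s 7 + s 5) = Real.log (s 5 + s 7) := by rw [add_comm]
    linear_combination (s 7 + s 6) * a7 + (s 0 + s 6) * a3 - (s 2 + s 1 + s 7 + s 6) * a10 - 2 * s 6 * a6
      + (s 6 + s 5) * a2 - (s 4 + s 3 + s 6 + s 5) * a5 - (s 3 + s 2) * c32 - (s 7 + s 6) * c76 - (s 6 + s 5) * c65
      - (s 4 + s 2) * c42 - (s 4 + s 1) * c41 - (s 3 + s 1) * c31 - (s 7 + s 5) * c75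

/-! ### Set-level cocycle for involutive generators with a loss-free point map -/

/-- **From a pointwise transfer to the set cocycle.** If `t ∈ S₇` is an involution and every critical point of
every `aOfS s` is sent to SOME critical point of `aOfS (t·s)` with the growth shifted by `ΔE(t; ·)`, then
`critVals (t·a) = critVals a + ΔE(t; a)` for every direction `a` (the reverse inclusion is the same statement at
`t·a`, using `t·(t·a) = a` and `ΔE(t; t·a) = −ΔE(t; a)`). -/
theorem critVals_permAct_eq_image_of_transfer {t : Equiv.Perm (Fin 7)} (ht : t * t = 1)
    (h : ∀ (s : Fin 8 → ℝ) (x y : ℝ), IsCritical (aOfS s) x y →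
      ∃ x' y', IsCritical (aOfS (permS t s)) x' y'
        ∧ growthLogR (pR (aOfS (permS t s))) (qR (aOfS (permS t s))) x' y'
          = growthLogR (pR (aOfS s)) (qR (aOfS s)) x y
            + (∑ i ∈ FIdx, h28 (aOfS (permS t s)) i * Real.log (h28 (aOfS (permS t s)) i)
              - ∑ i ∈ FIdx, h28 (aOfS s) i * Real.log (h28 (aOfS s) i)))
    (a : Dir) :
    critVals (permAct t a)
      = (fun v => v + ∑ i ∈ FIdx, (h28 (permAct t a) i * Real.log (h28 (permAct t a) i)
          - h28 a i * Real.log (h28 a i))) '' critVals a := by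
  have hss : permS t (permS t (sParam a)) = sParam a := by rw [permS_permS, ht, permS_one]
  have hΔ : ∑ i ∈ FIdx, (h28 (permAct t a) i * Real.log (h28 (permAct t a) i) - h28 a i * Real.log (h28 a i))
      = ∑ i ∈ FIdx, h28 (aOfS (permS t (sParam a))) i * Real.log (h28 (aOfS (permS t (sParam a))) i)
        - ∑ i ∈ FIdx, h28 a i * Real.log (h28 a i) := by
    rw [Finset.sum_sub_distrib]; rfl
  ext v
  simp only [critVals, Set.mem_setOf_eq, Set.mem_image]
  constructor
  · rintro ⟨x, y, hc, rfl⟩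
    have hc' : IsCritical (aOfS (permS t (sParam a))) x y := hc
    obtain ⟨x', y', hc2, hg2⟩ := h (permS t (sParam a)) x y hc'
    rw [hss, aOfS_sParam] at hc2 hg2
    refine ⟨growthLogR (pR a) (qR a) x' y', ⟨x', y', hc2, rfl⟩, ?_⟩
    rw [hΔ, hg2]
    change _ = growthLogR (pR (aOfS (permS t (sParam a)))) (qR (aOfS (permS t (sParam a)))) x y
    ring
  · rintro ⟨w, ⟨x, y, hc, rfl⟩, rfl⟩
    have hc' : IsCritical (aOfS (sParam a)) x y := by rwa [aOfS_sParam]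
    obtain ⟨x', y', hc2, hg2⟩ := h (sParam a) x y hc'
    rw [aOfS_sParam] at hg2
    refine ⟨x', y', hc2, ?_⟩
    rw [hΔ]
    change _ = growthLogR (pR (aOfS (permS t (sParam a)))) (qR (aOfS (permS t (sParam a)))) x' y'
    rw [hg2]

/-- **Set cocycle for `(34)`**, every direction: `critVals ((34)·a) = critVals a + ΔE((34); a)`. -/
theorem critVals_permAct_swap23 (a : Dir) :
    critVals (permAct (Equiv.swap 2 3) a)
      = (fun v => v + ∑ i ∈ FIdx, (h28 (permAct (Equiv.swap 2 3) a) i * Real.log (h28 (permAct (Equiv.swap 2 3) a) i)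
          - h28 a i * Real.log (h28 a i))) '' critVals a :=
  critVals_permAct_eq_image_of_transfer (Equiv.swap_mul_self 2 3)
    (fun _ x y hc => ⟨x, y, isCritical_growthLogR_swap23 hc⟩) a

/-- **Set cocycle for `(45)`**, every direction: `critVals ((45)·a) = critVals a + ΔE((45); a)`. -/
theorem critVals_permAct_swap34 (a : Dir) :
    critVals (permAct (Equiv.swap 3 4) a)
      = (fun v => v + ∑ i ∈ FIdx, (h28 (permAct (Equiv.swap 3 4) a) i * Real.log (h28 (permAct (Equiv.swap 3 4) a) i)
          - h28 a i * Real.log (h28 a i))) '' critVals a :=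
  critVals_permAct_eq_image_of_transfer (Equiv.swap_mul_self 3 4)
    (fun _ x y hc => ⟨x, y, isCritical_growthLogR_swap34 hc⟩) a

/-- `π = (14)(23)(57)` is an involution. -/
theorem mirror_mul_self :
    (Equiv.swap 0 3 * Equiv.swap 1 2 * Equiv.swap 4 6 : Equiv.Perm (Fin 7))
      * (Equiv.swap 0 3 * Equiv.swap 1 2 * Equiv.swap 4 6) = 1 := by
  decide

/-- **Set cocycle for BZ's reversal `π`**, every direction: `critVals (π·a) = critVals a + ΔE(π; a)`
(and `ΔE(π; a) = 0`, so `critVals (π·a) = critVals a`: `critVals_permAct_mirror_eq`). -/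
theorem critVals_permAct_mirror (a : Dir) :
    critVals (permAct (Equiv.swap 0 3 * Equiv.swap 1 2 * Equiv.swap 4 6) a)
      = (fun v => v + ∑ i ∈ FIdx, (h28 (permAct (Equiv.swap 0 3 * Equiv.swap 1 2 * Equiv.swap 4 6) a) i
            * Real.log (h28 (permAct (Equiv.swap 0 3 * Equiv.swap 1 2 * Equiv.swap 4 6) a) i)
          - h28 a i * Real.log (h28 a i))) '' critVals a :=
  critVals_permAct_eq_image_of_transfer mirror_mul_self (fun _ x y hc => ⟨y, x, isCritical_growthLogR_mirror hc⟩) a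

/-- `ΔE(π; a) = 0`: the reversal permutes the seventeen `F`-forms among themselves. -/
theorem entropyCocycle_mirror (a : Dir) :
    ∑ i ∈ FIdx, (h28 (permAct (Equiv.swap 0 3 * Equiv.swap 1 2 * Equiv.swap 4 6) a) i
            * Real.log (h28 (permAct (Equiv.swap 0 3 * Equiv.swap 1 2 * Equiv.swap 4 6) a) i)
          - h28 a i * Real.log (h28 a i)) = 0 := by
  obtain ⟨e0, e1, e2, e3, e4, e5, e6, e7⟩ := permS_mirror_apply (sParam a)
  conv_lhs => rw [← aOfS_sParam a]
  rw [entropyCocycle_aOfS, sum_FIdx_mul_log_aOfS, sum_FIdx_mul_log_aOfS]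
  simp only [e0, e1, e2, e3, e4, e5, e6, e7]
  have c32 : Real.log (sParam a 3 + sParam a 2) = Real.log (sParam a 2 + sParam a 3) := by rw [add_comm]
  have c21 : Real.log (sParam a 2 + sParam a 1) = Real.log (sParam a 1 + sParam a 2) := by rw [add_comm]
  have c43 : Real.log (sParam a 4 + sParam a 3) = Real.log (sParam a 3 + sParam a 4) := by rw [add_comm]
  have c76 : Real.log (sParam a 7 + sParam a 6) = Real.log (sParam a 6 + sParam a 7) := by rw [add_comm]
  have c65 : Real.log (sParam a 6 + sParam a 5) = Real.log (sParam a 5 + sParam a 6) := by rw [add_comm]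
  have c42 : Real.log (sParam a 4 + sParam a 2) = Real.log (sParam a 2 + sParam a 4) := by rw [add_comm]
  have c41 : Real.log (sParam a 4 + sParam a 1) = Real.log (sParam a 1 + sParam a 4) := by rw [add_comm]
  have c31 : Real.log (sParam a 3 + sParam a 1) = Real.log (sParam a 1 + sParam a 3) := by rw [add_comm]
  have c75 : Real.log (sParam a 7 + sParam a 5) = Real.log (sParam a 5 + sParam a 7) := by rw [add_comm]
  linear_combination (sParam a 3 + sParam a 2) * c32 + (sParam a 2 + sParam a 1) * c21
    + (sParam a 4 + sParam a 3) * c43 + (sParam a 7 + sParam a 6) * c76 + (sParam a 6 + sParam a 5) * c65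
    + (sParam a 4 + sParam a 2) * c42 + (sParam a 4 + sParam a 1) * c41 + (sParam a 3 + sParam a 1) * c31
    + (sParam a 7 + sParam a 5) * c75

/-- **BZ's reversal preserves the critical values**: `critVals (π·a) = critVals a` for every direction. -/
theorem critVals_permAct_mirror_eq (a : Dir) :
    critVals (permAct (Equiv.swap 0 3 * Equiv.swap 1 2 * Equiv.swap 4 6) a) = critVals a := by
  rw [critVals_permAct_mirror, entropyCocycle_mirror]
  simp

end Summit.KontsevichZagierPeriods.Zeta5Search.Barrier.ConeGamma

end
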